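import Literature.AlgebraicGeometry.Resolution.NeronPopescuLiftingGeneral
import Literature.AlgebraicGeometry.Resolution.NeronPopescuDesingularizeStrictlyStandard
import Literature.AlgebraicGeometry.Resolution.StrictlyStandardPowers
import HarnessLib

/-!
# Stacks 07F0 and 07F8: lifting a resolution along `π` (07CP + 07CT), and its iteration

Topic: `Literature/AlgebraicGeometry/Resolution`. The Stacks Project, *Smoothing Ring Maps*
(Tag 07BW):
> **Lemma 07F0.** Let `R` be a Noetherian ring. Let `Λ` be an `R`-algebra. Let `π ∈ R` and assume
> that `Ann_R(π) = Ann_R(π²)` and `Ann_Λ(π) = Ann_Λ(π²)`. Let `A → Λ` be an `R`-algebra map with `A` of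
> finite presentation and assume `π` is strictly standard in `A` over `R`. Let
> `A/π⁸A → C̄ → Λ/π⁸Λ` be a factorization with `C̄` of finite presentation. Then we can find a
> factorization `A → B → Λ` with `B` of finite presentation such that `R_π → B_π` is smooth and
> such that `H_{C̄/(R/π⁸R)} · Λ/π⁸Λ ⊂ √(H_{B/R} Λ) mod π⁸Λ`.
> *Proof.* Apply Lemma 07CP … By Lemma 07CT … We omit the verification …
>
> **Lemma 07F8.** Let `R → A → Λ ⊃ 𝔮` be as in Situation 07F7. Let `r ≥ 1` and `π_1, …, π_r ∈ R`
> map to elements of `𝔮`. Assume (1) … `Ann(π_i) = Ann(π_i²)` in `R/(π_1⁸, …, π_{i-1}⁸)R` and in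
> `Λ/(π_1⁸, …, π_{i-1}⁸)Λ`, (2) `π_i` maps to a strictly standard element in `A` over `R`. Then, if
> `R/(π_1⁸, …, π_r⁸)R → A/(π_1⁸, …, π_r⁸)A → Λ/(π_1⁸, …, π_r⁸)Λ ⊃ 𝔮/(π_1⁸, …, π_r⁸)Λ` can be
> resolved, so can `R → A → Λ ⊃ 𝔮`. *Proof.* … induction on `r` … Lemma 07F0 … Lemma 07CC.
This file PROVES both: `Stacks07F0_desingularizeLiftingApply` (from `Stacks07CP_general`,
`NeronPopescuLiftingGeneral.lean`, applied to `π⁴`, and `Stacks07CT_desingularizeStrictlyStandard`,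
`NeronPopescuDesingularizeStrictlyStandard.lean`, including the omitted verification), the case
`r = 1` of 07F8 for arbitrary quotient data (`canResolve_of_canResolve_quotient`; the implicit
bookkeeping `𝔥_A ⊆ 𝔥_B ⊄ 𝔮` uses the base change `H_{A/R} → H_{Ā/R̄}`,
`map_mem_singularIdeal_of_surjective`, i.e. stability of smoothness under base change proved by
the lifting property), and the iteration with the concrete quotients `R/J_i`,
`J_i = (ϖ_1⁸, …, ϖ_i⁸)` (`Stacks07F8.canResolve_of_canResolve_level`, descending induction, the
last step back to `R` itself being the degenerate instance `π = 0`). Renderings as in the two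
imported files: "`R_π → B_π` smooth" as `π ∈ H_{B/R}`; the inclusion of 07F0 as "every lift of
`γ(x)`, `x ∈ H_{C̄/R₈}`, lies in `H_{B/R}Λ`". The definitions in this file (`JJ`, `Rl`, `Cl`,
`Λl`, `φl`, `ql`) are the concrete quotient levels of the induction.
No named facts.

## References

* The Stacks Project, *Smoothing Ring Maps* (Tag 07BW), Lemmas 07F0, 07F8 with their proofs;
  Lemmas 07CP, 07CT, 07CC; proof of Lemma 07FE (the remark on annihilators of powers). [StacksProject]
-/


noncomputable section

namespace Literature.AlgebraicGeometry.Resolution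

open MvPolynomial

universe u

/-- `Ann(π) = Ann(π²)` propagates to higher powers: `π^{k+2} s = 0 → π^{k+1} s = 0`. [folklore] -/
theorem pow_succ_mul_eq_zero_of_pow_succ_succ {T : Type u} [CommRing T] (π : T)
    (h : ∀ s : T, π ^ 2 * s = 0 → π * s = 0) (k : ℕ) (s : T) (hs : π ^ (k + 2) * s = 0) :
    π ^ (k + 1) * s = 0 := by
  have : π ^ 2 * (π ^ k * s) = 0 := by rw [← mul_assoc, ← pow_add, add_comm]; exact hs
  have := h _ this
  rw [← mul_assoc, ← pow_succ'] at this
  exact this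

/-- `Ann(π) = Ann(π²)` implies `Ann(π⁴) = Ann(π⁸)` ("Note that if `Ann_Λ(π) = Ann_Λ(π²)`, then we have
`Ann_Λ(π) = Ann_Λ(π^c)` for all `c > 0`"). [cite: StacksProject, Tag 07FE] -/
theorem pow_four_mul_eq_zero {T : Type u} [CommRing T] (π : T)
    (h : ∀ s : T, π ^ 2 * s = 0 → π * s = 0) (s : T) (hs : (π ^ 4) ^ 2 * s = 0) : π ^ 4 * s = 0 := by
  rw [← pow_mul] at hs
  have h7 := pow_succ_mul_eq_zero_of_pow_succ_succ π h 6 s hs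
  have h6 := pow_succ_mul_eq_zero_of_pow_succ_succ π h 5 s h7
  have h5 := pow_succ_mul_eq_zero_of_pow_succ_succ π h 4 s h6
  exact pow_succ_mul_eq_zero_of_pow_succ_succ π h 3 s h5

/-- **Stacks, Lemma 07F0.** Let `R` be a Noetherian ring, `Λ` an `R`-algebra, `π ∈ R` with
`Ann_R(π) = Ann_R(π²)` and `Ann_Λ(π) = Ann_Λ(π²)`. Let `A → Λ` be an `R`-algebra map with `A` of finite
presentation and assume `π` is strictly standard in `A` over `R`. Let `A/π⁸A → C̄ → Λ/π⁸Λ` be a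
factorization with `C̄` of finite presentation (rendered with an arbitrary `R₈ ≅ R/π⁸R` — `R → R₈`
surjective with kernel `(π⁸)` —, `C̄` an `R₈`-algebra of finite presentation, `u : A → C̄` and
`γ : C̄ → Λ/I₈`, `I₈ = π⁸Λ`, with `γ ∘ u = (A → Λ → Λ/π⁸Λ)`). Then we can find a factorization
`A → B → Λ` with `B` of finite presentation such that `R_π → B_π` is smooth — rendered: `π ∈ H_{B/R}` —
and such that `H_{C̄/(R/π⁸R)} · Λ/π⁸Λ ⊂ √(H_{B/R} Λ) mod π⁸Λ` — rendered: for every `x ∈ C̄` with `C̄_x`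
(formally) smooth over `R₈`, every lift of `γ(x)` lies in `𝔥_B = √(H_{B/R} Λ)`.
Proof as printed: Lemma 07CP (applied to `π⁴`: `Stacks07CP_general`) gives `R → D → Λ` with
`C̄/π⁴C̄ → D/π⁴D → Λ/π⁴Λ`, and Lemma 07CT (`Stacks07CT_desingularizeStrictlyStandard`) gives `B` with
`A → B → Λ`, `D → B → Λ` and `H_{D/R} B ⊆ H_{B/R}`; the "omitted verification" is: `π⁴ ∈ H_{D/R}`
hence `π ∈ H_{B/R}`, and a lift `l` of `γ(x)` satisfies `l ≡ δ(d) mod π⁴Λ` for a lift `d ∈ H_{D/R}`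
of `ε(x)` (conclusion (c) of 07CP), whence `l ∈ H_{B/R} Λ`. [cite: StacksProject, Tag 07F0] -/
theorem Stacks07F0_desingularizeLiftingApply {R : Type u} [CommRing R] [IsNoetherianRing R]
    {Λ : Type u} [CommRing Λ] [Algebra R Λ] (π : R)
    (hR : ∀ s : R, π ^ 2 * s = 0 → π * s = 0)
    (hΛ : ∀ x : Λ, algebraMap R Λ π ^ 2 * x = 0 → algebraMap R Λ π * x = 0)
    {A : Type u} [CommRing A] [Algebra R A] [Algebra.FinitePresentation R A] (φ : A →ₐ[R] Λ)
    (hπ : IsStrictlyStandard R (algebraMap R A π))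
    (R₈ : Type u) [CommRing R₈] [Algebra R R₈] (hR₈ : Function.Surjective (algebraMap R R₈))
    (hker₈ : RingHom.ker (algebraMap R R₈) = Ideal.span {π ^ 8})
    (I₈ : Ideal Λ) (hI₈ : I₈ = Ideal.span {algebraMap R Λ π ^ 8})
    (Cb : Type u) [CommRing Cb] [Algebra R Cb] [Algebra R₈ Cb] [IsScalarTower R R₈ Cb]
    [Algebra.FinitePresentation R₈ Cb] (u : A →ₐ[R] Cb) (γ : Cb →ₐ[R] Λ ⧸ I₈)
    (huγ : ∀ a, γ (u a) = Ideal.Quotient.mk I₈ (φ a)) :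
    ∃ (B : Type u) (_ : CommRing B) (_ : Algebra R B) (v : A →ₐ[R] B) (w : B →ₐ[R] Λ),
      Algebra.FinitePresentation R B ∧ (∀ a, w (v a) = φ a) ∧
      algebraMap R B π ∈ singularIdeal R B ∧
      ∀ x : Cb, Algebra.FormallySmooth R₈ (Localization.Away x) →
        ∀ l : Λ, Ideal.Quotient.mk I₈ l = γ x → l ∈ (singularIdeal R B).map w := by
  classical
  -- 07CP with `π⁴`
  have hR4 : ∀ s : R, (π ^ 4) ^ 2 * s = 0 → π ^ 4 * s = 0 := pow_four_mul_eq_zero π hR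
  have hΛ4 : ∀ x : Λ, algebraMap R Λ (π ^ 4) ^ 2 * x = 0 → algebraMap R Λ (π ^ 4) * x = 0 := by
    intro x hx
    rw [map_pow] at hx ⊢
    exact pow_four_mul_eq_zero _ hΛ x hx
  have hker₈' : RingHom.ker (algebraMap R R₈) = Ideal.span {(π ^ 4) ^ 2} := by
    rw [hker₈, ← pow_mul]
  have hI₈' : I₈ = Ideal.span {algebraMap R Λ (π ^ 4) ^ 2} := by
    rw [hI₈, map_pow, ← pow_mul]
  obtain ⟨D, _, _, hDfp, δ, ε, hdiag, hπD, hc⟩ :=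
    Stacks07CPGen.Stacks07CP_general (π ^ 4) hR4 hΛ4 R₈ hR₈ hker₈' I₈ hI₈' Cb γ
  haveI := hDfp
  -- the map `χ : A/π⁴A → D/π⁴D`
  have hDeq : Ideal.span {algebraMap R D (π ^ 4)} = Ideal.span {algebraMap R D π ^ 4} := by
    rw [map_pow]
  let e : (D ⧸ Ideal.span {algebraMap R D (π ^ 4)}) ≃ₐ[R] D ⧸ Ideal.span {algebraMap R D π ^ 4} :=
    Ideal.quotientEquivAlgOfEq R hDeq
  let χ₀ : A →ₐ[R] D ⧸ Ideal.span {algebraMap R D π ^ 4} := (e.toAlgHom.comp ε).comp u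
  have hχ₀ : ∀ a ∈ Ideal.span {algebraMap R A π ^ 4}, χ₀ a = 0 := by
    intro a ha
    obtain ⟨b, rfl⟩ := Ideal.mem_span_singleton'.mp ha
    have h0 : χ₀ (algebraMap R A π ^ 4) = 0 := by
      rw [map_pow, AlgHom.commutes, ← Ideal.Quotient.mk_algebraMap,
        ← RingHom.map_pow (Ideal.Quotient.mk (Ideal.span {algebraMap R D π ^ 4})),
        Ideal.Quotient.eq_zero_iff_mem]
      exact Ideal.mem_span_singleton_self _
    rw [map_mul, h0, mul_zero]
  let χ : (A ⧸ Ideal.span {algebraMap R A π ^ 4}) →ₐ[R] D ⧸ Ideal.span {algebraMap R D π ^ 4} :=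
    Ideal.Quotient.liftₐ _ χ₀ hχ₀
  have hχmk : ∀ a, χ (Ideal.Quotient.mk _ a) = e (ε (u a)) := fun a => rfl
  have hχ : ∀ (a : A) (d : D), χ (Ideal.Quotient.mk _ a) = Ideal.Quotient.mk _ d →
      φ a - δ d ∈ Ideal.span {algebraMap R Λ π ^ 4} := by
    intro a d h
    rw [hχmk] at h
    have h' : Ideal.Quotient.mk (Ideal.span {algebraMap R D (π ^ 4)}) d = ε (u a) := by
      have := congrArg e.symm h
      rw [e.symm_apply_apply] at this
      rw [this]
      change (Ideal.quotientEquivAlgOfEq R hDeq).symm (Ideal.Quotient.mk _ d) = _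
      rw [Ideal.quotientEquivAlgOfEq_symm, Ideal.quotientEquivAlgOfEq_mk]
    have h2 := hdiag (u a) d (φ a) h' (huγ a).symm
    rw [Ideal.Quotient.eq, map_pow] at h2
    rw [← neg_sub]
    exact neg_mem h2
  obtain ⟨B, _, _, _, _, fA, g, hBfp, hgfA, hgD, hH⟩ :=
    Stacks07CT_desingularizeStrictlyStandard π hR hΛ φ δ hπ χ hχ
  have hπB : algebraMap R B (π ^ 4) ∈ singularIdeal R B := by
    have h1 := (hH _ hπD).2
    rwa [← IsScalarTower.algebraMap_apply] at h1
  refine ⟨B, inferInstance, inferInstance, fA, g, hBfp, hgfA, ?_, ?_⟩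
  · rw [map_pow] at hπB
    exact (isRadical_singularIdeal (R := R) (A := B)) ⟨4, hπB⟩
  · intro x hx l hl
    obtain ⟨d, hd⟩ := Ideal.Quotient.mk_surjective (ε x)
    have hdH : d ∈ singularIdeal R D := hc x hx d hd
    have h2 := hdiag x d l hd hl
    rw [Ideal.Quotient.eq, Ideal.mem_span_singleton'] at h2
    obtain ⟨t, ht⟩ := h2
    have hl' : l = δ d - t * algebraMap R Λ (π ^ 4) := by rw [ht]; ring
    rw [hl']
    refine Ideal.sub_mem _ ?_ (Ideal.mul_mem_left _ _ ?_)
    · rw [← hgD]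
      exact Ideal.mem_map_of_mem _ (hH d hdH).2
    · rw [← g.commutes]
      exact Ideal.mem_map_of_mem _ hπB

/-! ## Base change of smoothness along `R → R/π⁸R` -/

/-- **Smoothness of `C_c` over `R` passes to `C̄_{c̄}` over `R̄`** for a quotient `R → R̄` and the
induced quotient `C → C̄` (kernel generated by `ker(R → R̄)`): the lifting property, the lift through
`C_c → T` killing `ker(C → C̄)`. (Standard: smoothness is stable under base change; here in the form
needed for abstract quotient data.) [folklore] -/
theorem formallySmooth_away_of_surjective {R : Type u} [CommRing R] {R₈ : Type u} [CommRing R₈]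
    [Algebra R R₈] (hR₈ : Function.Surjective (algebraMap R R₈))
    {C : Type u} [CommRing C] [Algebra R C] {C₈ : Type u} [CommRing C₈] [Algebra R C₈]
    [Algebra R₈ C₈] [IsScalarTower R R₈ C₈] (fC : C →ₐ[R] C₈) (hfC : Function.Surjective fC)
    (hkerC : ∀ y ∈ RingHom.ker fC, y ∈ (RingHom.ker (algebraMap R R₈)).map (algebraMap R C))
    (c : C) [Algebra.FormallySmooth R (Localization.Away c)] :
    Algebra.FormallySmooth R₈ (Localization.Away (fC c)) := by
  set L := Localization.Away c
  set L₈ := Localization.Away (fC c)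
  letI : Algebra C L₈ := ((algebraMap C₈ L₈).comp fC.toRingHom).toAlgebra
  have halgCL₈ : ∀ y : C, algebraMap C L₈ y = algebraMap C₈ L₈ (fC y) := fun _ => rfl
  haveI : IsScalarTower R C L₈ := IsScalarTower.of_algebraMap_eq fun r => by
    rw [halgCL₈, fC.commutes, ← IsScalarTower.algebraMap_apply]
  -- `L → L₈`
  have hunitc : ∀ y : Submonoid.powers c, IsUnit ((IsScalarTower.toAlgHom R C L₈) y) := by
    rintro ⟨_, n, rfl⟩
    rw [map_pow, IsScalarTower.coe_toAlgHom', halgCL₈]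
    exact (IsLocalization.Away.algebraMap_isUnit (S := L₈) (fC c)).pow n
  let toL₈ : L →ₐ[R] L₈ := IsLocalization.liftAlgHom (M := Submonoid.powers c)
    (f := IsScalarTower.toAlgHom R C L₈) hunitc
  have htoL₈ : ∀ y : C, toL₈ (algebraMap C L y) = algebraMap C₈ L₈ (fC y) := fun y => by
    change IsLocalization.lift (M := Submonoid.powers c) hunitc (algebraMap C L y) = _
    rw [IsLocalization.lift_eq]
    rfl
  refine Algebra.FormallySmooth.of_comp_surjective fun T _ _ N hN g => ?_
  letI : Algebra R T := ((algebraMap R₈ T).comp (algebraMap R R₈)).toAlgebra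
  haveI : IsScalarTower R R₈ T := IsScalarTower.of_algebraMap_eq fun _ => rfl
  let h : L →ₐ[R] T ⧸ N := (g.restrictScalars R).comp toL₈
  have hN' : IsNilpotent N := ⟨2, hN⟩
  let ht : L →ₐ[R] T := Algebra.FormallySmooth.lift N hN' h
  have hht : ∀ x, Ideal.Quotient.mk N (ht x) = h x := fun x =>
    Algebra.FormallySmooth.mk_lift N hN' h x
  -- `C₈ → T`
  have hkill : ∀ y ∈ RingHom.ker fC, (ht.comp (IsScalarTower.toAlgHom R C L)) y = 0 := by
    intro y hy
    refine Submodule.span_induction (p := fun y _ => (ht.comp (IsScalarTower.toAlgHom R C L)) y = 0)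
      ?_ ?_ ?_ ?_ (hkerC y hy)
    · rintro _ ⟨r, hr, rfl⟩
      rw [AlgHom.comp_apply, IsScalarTower.coe_toAlgHom', ← IsScalarTower.algebraMap_apply,
        AlgHom.commutes]
      change algebraMap R₈ T (algebraMap R R₈ r) = 0
      rw [RingHom.mem_ker.mp hr, map_zero]
    · exact map_zero _
    · intro a b _ _ ha hb
      rw [map_add, ha, hb, add_zero]
    · intro a b _ hb
      rw [smul_eq_mul, map_mul, hb, mul_zero]
  let e : (C ⧸ RingHom.ker fC) ≃ₐ[R] C₈ := Ideal.quotientKerAlgEquivOfSurjective hfC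
  let h₈ : C₈ →ₐ[R] T :=
    (Ideal.Quotient.liftₐ (RingHom.ker fC) (ht.comp (IsScalarTower.toAlgHom R C L)) hkill).comp
      e.symm.toAlgHom
  have he : ∀ y : C, e.symm (fC y) = Ideal.Quotient.mk _ y := fun y => by
    rw [AlgEquiv.symm_apply_eq]
    rfl
  have hh₈ : ∀ y : C, h₈ (fC y) = ht (algebraMap C L y) := fun y => by
    change Ideal.Quotient.liftₐ (RingHom.ker fC) (ht.comp (IsScalarTower.toAlgHom R C L)) hkill
      (e.symm (fC y)) = _
    rw [he]
    rfl
  -- `L₈ → T`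
  have hunit₈ : ∀ y : Submonoid.powers (fC c), IsUnit (h₈ y) := by
    rintro ⟨_, n, rfl⟩
    rw [map_pow, hh₈]
    exact ((IsLocalization.Away.algebraMap_isUnit (S := L) c).map ht).pow n
  let g₀ : L₈ →ₐ[R] T := IsLocalization.liftAlgHom (M := Submonoid.powers (fC c)) (f := h₈) hunit₈
  have hg₀ : ∀ y : C₈, g₀ (algebraMap C₈ L₈ y) = h₈ y := fun y => by
    change IsLocalization.lift (M := Submonoid.powers (fC c)) hunit₈ (algebraMap C₈ L₈ y) = _
    rw [IsLocalization.lift_eq]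
    rfl
  have hcomm : ∀ r : R₈, g₀ (algebraMap R₈ L₈ r) = algebraMap R₈ T r := by
    intro r
    obtain ⟨r, rfl⟩ := hR₈ r
    rw [← IsScalarTower.algebraMap_apply, AlgHom.commutes]
    rfl
  let ĝ : L₈ →ₐ[R₈] T := ⟨g₀.toRingHom, hcomm⟩
  refine ⟨ĝ, ?_⟩
  apply AlgHom.coe_ringHom_injective
  refine IsLocalization.ringHom_ext (Submonoid.powers (fC c)) (RingHom.ext fun y => ?_)
  obtain ⟨y, rfl⟩ := hfC y
  change Ideal.Quotient.mk N (g₀ (algebraMap C₈ L₈ (fC y))) = g (algebraMap C₈ L₈ (fC y))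
  rw [hg₀, hh₈, hht]
  change g (toL₈ (algebraMap C L y)) = _
  rw [htoL₈]

/-- Hence `H_{C/R}` maps into `H_{C̄/R̄}` (for `C`, `C̄` of finite presentation). [folklore] -/
theorem map_mem_singularIdeal_of_surjective {R : Type u} [CommRing R] {R₈ : Type u} [CommRing R₈]
    [Algebra R R₈] (hR₈ : Function.Surjective (algebraMap R R₈))
    {C : Type u} [CommRing C] [Algebra R C] [Algebra.FinitePresentation R C]
    {C₈ : Type u} [CommRing C₈] [Algebra R C₈] [Algebra R₈ C₈] [IsScalarTower R R₈ C₈]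
    [Algebra.FinitePresentation R₈ C₈] (fC : C →ₐ[R] C₈) (hfC : Function.Surjective fC)
    (hkerC : ∀ y ∈ RingHom.ker fC, y ∈ (RingHom.ker (algebraMap R R₈)).map (algebraMap R C))
    {c : C} (hc : c ∈ singularIdeal R C) : fC c ∈ singularIdeal R₈ C₈ := by
  rw [mem_singularIdeal_iff] at hc ⊢
  haveI := (Algebra.basicOpen_subset_smoothLocus_iff (R := R) (f := c)).mp hc
  exact (Algebra.basicOpen_subset_smoothLocus_iff (R := R₈) (f := fC c)).mpr
    (formallySmooth_away_of_surjective hR₈ fC hfC hkerC c)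

/-! ## Stacks 07F8 (the case `r = 1`): lifting a resolution from `R/π⁸R` to `R` -/

/-- **Stacks, Lemma 07F8, case `r = 1`.** Let `R → A → Λ ⊃ 𝔮` be as in Situation 07F7 (`R`
Noetherian, `A` of finite presentation, `𝔮 ⊂ Λ` prime) and `π ∈ R` mapping into `𝔮` with
(1) `Ann_R(π) = Ann_R(π²)`, `Ann_Λ(π) = Ann_Λ(π²)` and (2) `π` strictly standard in `A` over `R`. If
`R/π⁸R → A/π⁸A → Λ/π⁸Λ ⊃ 𝔮/π⁸Λ` can be resolved, so can `R → A → Λ ⊃ 𝔮` ("Here the assumption is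
that there exists a factorization `A/π⁸ → C̄ → Λ/π⁸` which resolves the situation modulo `π⁸`.
Conditions (1) and (2) are the assumptions needed to apply Lemma 07F0. Thus we can "lift" the
resolution `C̄` to a resolution of `R → A → Λ ⊃ 𝔮`."). The quotients are arbitrary quotient data
(`R → R₈`, `A → A₈`, `Λ → Λ₈` surjective with kernels generated by `π⁸`, `φ₈`, `𝔮₈` compatible);
the verification `𝔥_A ⊆ 𝔥_B ⊄ 𝔮` (implicit in the printed "lift") uses `Stacks07F0` and the base
change `H_{A/R} → H_{A₈/R₈}`. [cite: StacksProject, Tag 07F8] -/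
theorem canResolve_of_canResolve_quotient {R : Type u} [CommRing R] [IsNoetherianRing R]
    {C : Type u} [CommRing C] [Algebra R C] [Algebra.FinitePresentation R C]
    {Λ : Type u} [CommRing Λ] [Algebra R Λ] (φ : C →ₐ[R] Λ) (q : Ideal Λ) [q.IsPrime] (π : R)
    (hR : ∀ s : R, π ^ 2 * s = 0 → π * s = 0)
    (hΛ : ∀ x : Λ, algebraMap R Λ π ^ 2 * x = 0 → algebraMap R Λ π * x = 0)
    (hπ : IsStrictlyStandard R (algebraMap R C π))
    (R₈ : Type u) [CommRing R₈] [Algebra R R₈] (hR₈ : Function.Surjective (algebraMap R R₈))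
    (hkerR : RingHom.ker (algebraMap R R₈) = Ideal.span {π ^ 8})
    (C₈ : Type u) [CommRing C₈] [Algebra R C₈] [Algebra R₈ C₈] [IsScalarTower R R₈ C₈]
    [Algebra.FinitePresentation R₈ C₈] (fC : C →ₐ[R] C₈) (hfC : Function.Surjective fC)
    (hkerC : RingHom.ker fC = Ideal.span {algebraMap R C π ^ 8})
    (Λ₈ : Type u) [CommRing Λ₈] [Algebra R Λ₈] [Algebra R₈ Λ₈] [IsScalarTower R R₈ Λ₈]
    (fΛ : Λ →ₐ[R] Λ₈) (hfΛ : Function.Surjective fΛ)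
    (hkerΛ : RingHom.ker fΛ = Ideal.span {algebraMap R Λ π ^ 8})
    (φ₈ : C₈ →ₐ[R₈] Λ₈) (hφ₈ : ∀ c, φ₈ (fC c) = fΛ (φ c))
    (q₈ : Ideal Λ₈) [q₈.IsPrime] (hq₈ : q₈.comap fΛ = q)
    (hres : CanResolve R₈ φ₈ q₈) : CanResolve R φ q := by
  classical
  obtain ⟨B₈, _, _, hB₈fp, v₈, w₈, hwv₈, hincl₈, hnot₈⟩ := hres
  haveI := hB₈fp
  letI : Algebra R B₈ := ((algebraMap R₈ B₈).comp (algebraMap R R₈)).toAlgebra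
  haveI : IsScalarTower R R₈ B₈ := IsScalarTower.of_algebraMap_eq fun _ => rfl
  -- the data for Lemma 07F0
  let u : C →ₐ[R] B₈ := (v₈.restrictScalars R).comp fC
  let I₈ : Ideal Λ := RingHom.ker fΛ
  let eΛ : (Λ ⧸ I₈) ≃ₐ[R] Λ₈ := Ideal.quotientKerAlgEquivOfSurjective hfΛ
  have heΛ : ∀ l, eΛ (Ideal.Quotient.mk I₈ l) = fΛ l := fun l => rfl
  let γ : B₈ →ₐ[R] Λ ⧸ I₈ := eΛ.symm.toAlgHom.comp (w₈.restrictScalars R)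
  have hγ : ∀ b, γ b = eΛ.symm (w₈ b) := fun b => rfl
  have huγ : ∀ c, γ (u c) = Ideal.Quotient.mk I₈ (φ c) := fun c => by
    rw [hγ, AlgEquiv.symm_apply_eq, heΛ]
    change w₈ (v₈ (fC c)) = _
    rw [← AlgHom.comp_apply, hwv₈, hφ₈]
  obtain ⟨B, _, _, v, w, hBfp, hwv, hπB, hlift⟩ :=
    Stacks07F0_desingularizeLiftingApply π hR hΛ φ hπ R₈ hR₈ hkerR I₈ hkerΛ B₈ u γ huγ
  haveI := hBfp
  -- `M = H_{B/R} Λ` contains `π` and `ker(Λ → Λ₈)`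
  set M : Ideal Λ := (singularIdeal R B).map w with hM
  have hπM : algebraMap R Λ π ∈ M := by
    rw [← w.commutes]
    exact Ideal.mem_map_of_mem _ hπB
  have hkerM : ∀ l ∈ RingHom.ker fΛ, l ∈ M := by
    intro l hl
    rw [hkerΛ, Ideal.mem_span_singleton'] at hl
    obtain ⟨t, rfl⟩ := hl
    exact Ideal.mul_mem_left _ _ (Ideal.pow_mem_of_mem M hπM 8 (by norm_num))
  -- every lift of an element of `H_{B₈} Λ₈` lies in `M`
  have hP : ∀ y ∈ (singularIdeal R₈ B₈).map w₈, ∀ l : Λ, fΛ l = y → l ∈ M := by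
    intro y hy
    refine Submodule.span_induction (p := fun y _ => ∀ l : Λ, fΛ l = y → l ∈ M) ?_ ?_ ?_ ?_ hy
    · rintro _ ⟨x, hx, rfl⟩ l hl
      have hxs : Algebra.FormallySmooth R₈ (Localization.Away x) :=
        (Algebra.basicOpen_subset_smoothLocus_iff (R := R₈) (f := x)).mp
          ((mem_singularIdeal_iff (R := R₈) (a := x)).mp hx)
      refine hlift x hxs l ?_
      rw [hγ, eq_comm, AlgEquiv.symm_apply_eq, heΛ, hl]
    · intro l hl
      exact hkerM l hl
    · intro a b _ _ ha hb l hl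
      obtain ⟨la, hla⟩ := hfΛ a
      have hlb : fΛ (l - la) = b := by rw [map_sub, hl, hla, add_sub_cancel_left]
      have h1 := ha _ hla
      have h2 := hb _ hlb
      have : l = la + (l - la) := by ring
      rw [this]
      exact Ideal.add_mem _ h1 h2
    · intro a y _ hy l hl
      obtain ⟨κ, hκ⟩ := hfΛ a
      obtain ⟨ly, hly⟩ := hfΛ y
      have h1 : ly ∈ M := hy ly hly
      have h2 : l - κ * ly ∈ M := hkerM _ (by
        rw [RingHom.mem_ker, map_sub, map_mul, hl, hκ, hly, smul_eq_mul, sub_self])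
      have : l = (l - κ * ly) + κ * ly := by ring
      rw [this]
      exact Ideal.add_mem _ h2 (Ideal.mul_mem_left _ κ h1)
  have hkerC' : ∀ y ∈ RingHom.ker fC, y ∈ (RingHom.ker (algebraMap R R₈)).map (algebraMap R C) := by
    intro y hy
    rw [hkerC, Ideal.mem_span_singleton'] at hy
    obtain ⟨t, rfl⟩ := hy
    refine Ideal.mul_mem_left _ _ ?_
    rw [← map_pow]
    exact Ideal.mem_map_of_mem _ (by rw [hkerR]; exact Ideal.mem_span_singleton_self _)
  refine ⟨B, inferInstance, inferInstance, hBfp, v, w, AlgHom.ext hwv, ?_, ?_⟩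
  · -- `𝔥_A ⊆ 𝔥_B`
    show ((singularIdeal R C).map φ).radical ≤ ((singularIdeal R B).map w).radical
    refine Ideal.radical_le_radical_iff.mpr ?_
    rw [Ideal.map_le_iff_le_comap]
    intro c hc
    rw [Ideal.mem_comap]
    have h1 : fC c ∈ singularIdeal R₈ C₈ :=
      map_mem_singularIdeal_of_surjective hR₈ fC hfC hkerC' hc
    have h2 : φ₈ (fC c) ∈ hIdeal R₈ w₈ := hincl₈ (Ideal.le_radical (Ideal.mem_map_of_mem _ h1))
    obtain ⟨m, hm⟩ := h2
    rw [hφ₈, ← map_pow] at hm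
    exact ⟨m, hP _ hm _ rfl⟩
  · -- `𝔥_B ⊄ 𝔮`
    intro hle
    apply hnot₈
    refine (Ideal.IsPrime.radical_le_iff ‹q₈.IsPrime›).mpr ?_
    rw [Ideal.map_le_iff_le_comap]
    intro x hx
    rw [Ideal.mem_comap]
    obtain ⟨l, hl⟩ := hfΛ (w₈ x)
    have hlM : l ∈ M := hP _ (Ideal.mem_map_of_mem _ hx) l hl
    have hlq : l ∈ q := hle (Ideal.le_radical hlM)
    rw [← hq₈, Ideal.mem_comap, hl] at hlq
    exact hlq

/-! ## Tools for the induction of Stacks 07F8 with concrete quotient levels -/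

namespace Stacks07F8

variable {R : Type u} [CommRing R] {d : ℕ} (ϖ : Fin d → R)

/-- The ideals `J_i = (ϖ_j⁸ : j < i)` of the induction ("`R/(π_1^8, …, π_{i-1}^8)R`").
[cite: StacksProject, Tag 07F8] -/
def JJ (i : ℕ) : Ideal R := Ideal.span ((fun j : Fin d => ϖ j ^ 8) '' {j | (j : ℕ) < i})

/-- `J_i ⊆ J_{i'}` for `i ≤ i'`. [folklore] -/
theorem JJ_mono {i i' : ℕ} (h : i ≤ i') : JJ ϖ i ≤ JJ ϖ i' :=
  Ideal.span_mono (Set.image_mono fun _ hj => lt_of_lt_of_le hj h)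

/-- `J_0 = 0`. [folklore] -/
theorem JJ_zero : JJ ϖ 0 = ⊥ := by
  rw [JJ, show {j : Fin d | (j : ℕ) < 0} = ∅ from Set.eq_empty_of_forall_notMem fun j hj =>
    Nat.not_lt_zero _ hj, Set.image_empty, Ideal.span_empty]

/-- `J_{i+1} = J_i + (ϖ_i⁸)`. [folklore] -/
theorem JJ_succ (i : ℕ) (hi : i < d) : JJ ϖ (i + 1) = JJ ϖ i ⊔ Ideal.span {ϖ ⟨i, hi⟩ ^ 8} := by
  rw [JJ, JJ, ← Ideal.span_union, ← Set.image_singleton (f := fun j : Fin d => ϖ j ^ 8),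
    ← Set.image_union]
  congr 1
  congr 1
  ext j
  simp only [Set.mem_setOf_eq, Set.mem_union, Set.mem_singleton_iff, Nat.lt_succ_iff_lt_or_eq,
    Fin.ext_iff]

/-- The `J_i` are finitely generated. [folklore] -/
theorem JJ_fg (i : ℕ) : (JJ ϖ i).FG :=
  ⟨((Set.toFinite _).image _).toFinset, by rw [Set.Finite.coe_toFinset]; rfl⟩

variable {C : Type u} [CommRing C] [Algebra R C] {Λ : Type u} [CommRing Λ] [Algebra R Λ]
  (φ : C →ₐ[R] Λ) (q : Ideal Λ)

/-- `R_i = R/J_i`. [cite: StacksProject, Tag 07F8] -/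
abbrev Rl (i : ℕ) : Type u := R ⧸ JJ ϖ i

/-- `A_i = A/J_i A`. [cite: StacksProject, Tag 07F8] -/
abbrev Cl (i : ℕ) : Type u := C ⧸ (JJ ϖ i).map (algebraMap R C)

/-- `Λ_i = Λ/J_i Λ`. [cite: StacksProject, Tag 07F8] -/
abbrev Λl (i : ℕ) : Type u := Λ ⧸ (JJ ϖ i).map (algebraMap R Λ)

/-- `IA ⊆ φ⁻¹(IΛ)`. [folklore] -/
theorem map_le_comap_map (I : Ideal R) :
    I.map (algebraMap R C) ≤ (I.map (algebraMap R Λ)).comap φ := by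
  rw [Ideal.map_le_iff_le_comap]
  intro r hr
  rw [Ideal.mem_comap, Ideal.mem_comap, AlgHom.commutes]
  exact Ideal.mem_map_of_mem _ hr

/-- `A_i → Λ_i` induced by `A → Λ`. [cite: StacksProject, Tag 07F8] -/
def φl (i : ℕ) : Cl ϖ i (C := C) →ₐ[Rl ϖ i] Λl ϖ i (Λ := Λ) :=
  AlgHom.extendScalarsOfSurjective (S := Rl ϖ i) Ideal.Quotient.mk_surjective
    (Ideal.quotientMapₐ _ φ (map_le_comap_map φ (JJ ϖ i)))

/-- Formula. [folklore] -/
theorem φl_mk (i : ℕ) (c : C) : φl ϖ φ i (Ideal.Quotient.mk _ c) = Ideal.Quotient.mk _ (φ c) := rfl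

/-- `𝔮_i = 𝔮/J_i Λ`. [cite: StacksProject, Tag 07F8] -/
abbrev ql (i : ℕ) : Ideal (Λl ϖ i (Λ := Λ)) := q.map (Ideal.Quotient.mk _)

variable (hq : ∀ j, algebraMap R Λ (ϖ j) ∈ q)

include hq in
/-- `J_i Λ ⊆ 𝔮`. [folklore] -/
theorem map_JJ_le (i : ℕ) [q.IsPrime] : (JJ ϖ i).map (algebraMap R Λ) ≤ q := by
  rw [Ideal.map_le_iff_le_comap, JJ, Ideal.span_le]
  rintro _ ⟨j, -, rfl⟩
  rw [SetLike.mem_coe, Ideal.mem_comap, map_pow]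
  exact Ideal.pow_mem_of_mem q (hq j) 8 (by norm_num)

include hq in
/-- `𝔮_i` is prime. [folklore] -/
theorem ql_isPrime (i : ℕ) [q.IsPrime] : (ql ϖ q i).IsPrime :=
  Ideal.map_isPrime_of_surjective Ideal.Quotient.mk_surjective
    (by rw [Ideal.mk_ker]; exact map_JJ_le ϖ q hq i)

/-- `A/IA` is of finite presentation over `R/I`. [folklore] -/
theorem finitePresentation_quotient [Algebra.FinitePresentation R C] (I : Ideal R) (hI : I.FG) :
    Algebra.FinitePresentation (R ⧸ I) (C ⧸ I.map (algebraMap R C)) := by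
  haveI : Algebra.FinitePresentation R (C ⧸ I.map (algebraMap R C)) :=
    Algebra.FinitePresentation.quotient (hI.map _)
  exact Algebra.FinitePresentation.of_restrict_scalars_finitePresentation R (R ⧸ I) _

/-- The colon condition passes to the quotient. [folklore] -/
theorem ann_quotient {T : Type u} [CommRing T] (J : Ideal T) (π : T)
    (h : ∀ y : T, π ^ 2 * y ∈ J → π * y ∈ J) (s : T ⧸ J)
    (hs : Ideal.Quotient.mk J π ^ 2 * s = 0) : Ideal.Quotient.mk J π * s = 0 := by
  obtain ⟨y, rfl⟩ := Ideal.Quotient.mk_surjective s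
  rw [← map_pow, ← map_mul, Ideal.Quotient.eq_zero_iff_mem] at hs
  rw [← map_mul, Ideal.Quotient.eq_zero_iff_mem]
  exact h y hs


section Step

variable [IsNoetherianRing R] [Algebra.FinitePresentation R C] [q.IsPrime]
  (hRann : ∀ (i : Fin d) (y : R), ϖ i ^ 2 * y ∈ JJ ϖ i → ϖ i * y ∈ JJ ϖ i)
  (hΛann : ∀ (i : Fin d) (y : Λ), algebraMap R Λ (ϖ i) ^ 2 * y ∈ (JJ ϖ i).map (algebraMap R Λ) →
    algebraMap R Λ (ϖ i) * y ∈ (JJ ϖ i).map (algebraMap R Λ))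
  (hss : ∀ i, IsStrictlyStandard R (algebraMap R C (ϖ i)))

include hRann hΛann hss hq in
/-- **The induction step of Stacks 07F8** with the concrete quotients `R/J_{i+1}`, `A/J_{i+1}A`,
`Λ/J_{i+1}Λ` of `R/J_i`, `A/J_iA`, `Λ/J_iΛ` by `ϖ_i⁸` ("we apply the induction hypothesis for
`r - 1` to the situation `R/π_1⁸ → A/π_1⁸ → Λ/π_1⁸ ⊃ 𝔮/π_1⁸Λ`. Note that property (2) is preserved
by Lemma 07CC."). [cite: StacksProject, Tag 07F8] -/
theorem step_level (i : ℕ) (hi : i < d)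
    (h : CanResolve (Rl ϖ (i + 1)) (φl ϖ φ (i + 1)) (ql ϖ q (i + 1))) :
    CanResolve (Rl ϖ i) (φl ϖ φ i) (ql ϖ q i) := by
  classical
  set i' : Fin d := ⟨i, hi⟩ with hi'
  have hmono : JJ ϖ i ≤ JJ ϖ (i + 1) := JJ_mono ϖ (Nat.le_succ i)
  haveI : (ql ϖ q i).IsPrime := ql_isPrime ϖ q hq i
  haveI : (ql ϖ q (i + 1)).IsPrime := ql_isPrime ϖ q hq (i + 1)
  haveI : Algebra.FinitePresentation (Rl ϖ i) (Cl ϖ i (C := C)) :=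
    finitePresentation_quotient (JJ ϖ i) (JJ_fg ϖ i)
  haveI : Algebra.FinitePresentation (Rl ϖ (i + 1)) (Cl ϖ (i + 1) (C := C)) :=
    finitePresentation_quotient (JJ ϖ (i + 1)) (JJ_fg ϖ (i + 1))
  -- `R_{i+1}`, `A_{i+1}`, `Λ_{i+1}` as algebras over `R_i`
  letI algR : Algebra (Rl ϖ i) (Rl ϖ (i + 1)) := (Ideal.Quotient.factor hmono).toAlgebra
  have halgR : ∀ r : R, algebraMap (Rl ϖ i) (Rl ϖ (i + 1)) (Ideal.Quotient.mk _ r) =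
      Ideal.Quotient.mk _ r := fun _ => rfl
  have hleC : JJ ϖ i ≤ ((JJ ϖ (i + 1)).map (algebraMap R C)).comap (algebraMap R C) :=
    hmono.trans Ideal.le_comap_map
  have hleΛ : JJ ϖ i ≤ ((JJ ϖ (i + 1)).map (algebraMap R Λ)).comap (algebraMap R Λ) :=
    hmono.trans Ideal.le_comap_map
  letI algC : Algebra (Rl ϖ i) (Cl ϖ (i + 1) (C := C)) := Ideal.Quotient.algebraQuotientOfLEComap hleC
  letI algΛ : Algebra (Rl ϖ i) (Λl ϖ (i + 1) (Λ := Λ)) := Ideal.Quotient.algebraQuotientOfLEComap hleΛ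
  have halgC : ∀ r : R, algebraMap (Rl ϖ i) (Cl ϖ (i + 1) (C := C)) (Ideal.Quotient.mk _ r) =
      Ideal.Quotient.mk _ (algebraMap R C r) := fun _ => rfl
  have halgΛ : ∀ r : R, algebraMap (Rl ϖ i) (Λl ϖ (i + 1) (Λ := Λ)) (Ideal.Quotient.mk _ r) =
      Ideal.Quotient.mk _ (algebraMap R Λ r) := fun _ => rfl
  haveI : IsScalarTower (Rl ϖ i) (Rl ϖ (i + 1)) (Cl ϖ (i + 1) (C := C)) :=
    IsScalarTower.of_algebraMap_eq fun r => by
      obtain ⟨r, rfl⟩ := Ideal.Quotient.mk_surjective r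
      rw [halgC, halgR]
      rfl
  haveI : IsScalarTower (Rl ϖ i) (Rl ϖ (i + 1)) (Λl ϖ (i + 1) (Λ := Λ)) :=
    IsScalarTower.of_algebraMap_eq fun r => by
      obtain ⟨r, rfl⟩ := Ideal.Quotient.mk_surjective r
      rw [halgΛ, halgR]
      rfl
  haveI : IsScalarTower R (Rl ϖ i) (Cl ϖ (i + 1) (C := C)) :=
    IsScalarTower.of_algebraMap_eq fun r => rfl
  haveI : IsScalarTower R (Rl ϖ i) (Λl ϖ (i + 1) (Λ := Λ)) :=
    IsScalarTower.of_algebraMap_eq fun r => rfl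
  -- the maps
  let fC : Cl ϖ i (C := C) →ₐ[Rl ϖ i] Cl ϖ (i + 1) (C := C) :=
    AlgHom.extendScalarsOfSurjective (S := Rl ϖ i) Ideal.Quotient.mk_surjective
      (Ideal.Quotient.factorₐ R (Ideal.map_mono hmono))
  have hfC : ∀ c : C, fC (Ideal.Quotient.mk _ c) = Ideal.Quotient.mk _ c := fun _ => rfl
  let fΛ : Λl ϖ i (Λ := Λ) →ₐ[Rl ϖ i] Λl ϖ (i + 1) (Λ := Λ) :=
    AlgHom.extendScalarsOfSurjective (S := Rl ϖ i) Ideal.Quotient.mk_surjective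
      (Ideal.Quotient.factorₐ R (Ideal.map_mono hmono))
  have hfΛ : ∀ l : Λ, fΛ (Ideal.Quotient.mk _ l) = Ideal.Quotient.mk _ l := fun _ => rfl
  -- `π = ϖ_i mod J_i`
  let π : Rl ϖ i := Ideal.Quotient.mk _ (ϖ i')
  have hπC : algebraMap (Rl ϖ i) (Cl ϖ i (C := C)) π = Ideal.Quotient.mk _ (algebraMap R C (ϖ i')) :=
    rfl
  have hπΛ : algebraMap (Rl ϖ i) (Λl ϖ i (Λ := Λ)) π = Ideal.Quotient.mk _ (algebraMap R Λ (ϖ i')) :=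
    rfl
  -- membership in the successor ideals
  have hmemJ : ∀ x : R, x ∈ JJ ϖ (i + 1) ↔ x ∈ JJ ϖ i ⊔ Ideal.span {ϖ i' ^ 8} := fun x => by
    rw [JJ_succ ϖ i hi]
  have hmapJ : ∀ {T : Type u} [CommRing T] [Algebra R T] (x : T),
      x ∈ (JJ ϖ (i + 1)).map (algebraMap R T) ↔
        x ∈ (JJ ϖ i).map (algebraMap R T) ⊔ Ideal.span {algebraMap R T (ϖ i') ^ 8} := by
    intro T _ _ x
    rw [JJ_succ ϖ i hi, Ideal.map_sup, Ideal.map_span, Set.image_singleton, map_pow]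
  refine canResolve_of_canResolve_quotient (φl ϖ φ i) (ql ϖ q i) π ?_ ?_ ?_ (Rl ϖ (i + 1))
    ?_ ?_ (Cl ϖ (i + 1)) fC ?_ ?_ (Λl ϖ (i + 1)) fΛ ?_ ?_ (φl ϖ φ (i + 1)) ?_ (ql ϖ q (i + 1)) ?_ h
  · -- `Ann_{R_i}(π) = Ann_{R_i}(π²)`
    exact ann_quotient (JJ ϖ i) (ϖ i') (hRann i')
  · -- `Ann_{Λ_i}(π) = Ann_{Λ_i}(π²)`
    intro x hx
    rw [hπΛ] at hx ⊢
    exact ann_quotient _ _ (hΛann i') x hx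
  · -- `π` strictly standard in `A_i` (Lemma 07CC)
    rw [hπC]
    exact (hss i').quotient_map (JJ ϖ i)
  · -- `R_i → R_{i+1}` surjective
    intro x
    obtain ⟨x, rfl⟩ := Ideal.Quotient.mk_surjective x
    exact ⟨Ideal.Quotient.mk _ x, halgR x⟩
  · -- kernel `= (π⁸)`
    ext x
    obtain ⟨x, rfl⟩ := Ideal.Quotient.mk_surjective x
    rw [RingHom.mem_ker, halgR, Ideal.Quotient.eq_zero_iff_mem, hmemJ,
      show Ideal.span {π ^ 8} = (Ideal.span {ϖ i' ^ 8}).map (Ideal.Quotient.mk (JJ ϖ i)) by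
        rw [Ideal.map_span, Set.image_singleton, map_pow],
      Ideal.mem_quotient_iff_mem_sup, sup_comm]
  · -- `A_i → A_{i+1}` surjective
    intro x
    obtain ⟨x, rfl⟩ := Ideal.Quotient.mk_surjective x
    exact ⟨Ideal.Quotient.mk _ x, hfC x⟩
  · -- kernel
    ext x
    obtain ⟨x, rfl⟩ := Ideal.Quotient.mk_surjective x
    rw [RingHom.mem_ker, hfC, Ideal.Quotient.eq_zero_iff_mem, hmapJ, hπC,
      show Ideal.span {Ideal.Quotient.mk ((JJ ϖ i).map (algebraMap R C)) (algebraMap R C (ϖ i')) ^ 8}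
          = (Ideal.span {algebraMap R C (ϖ i') ^ 8}).map (Ideal.Quotient.mk _) by
        rw [Ideal.map_span, Set.image_singleton, map_pow],
      Ideal.mem_quotient_iff_mem_sup, sup_comm]
  · -- `Λ_i → Λ_{i+1}` surjective
    intro x
    obtain ⟨x, rfl⟩ := Ideal.Quotient.mk_surjective x
    exact ⟨Ideal.Quotient.mk _ x, hfΛ x⟩
  · -- kernel
    ext x
    obtain ⟨x, rfl⟩ := Ideal.Quotient.mk_surjective x
    rw [RingHom.mem_ker, hfΛ, Ideal.Quotient.eq_zero_iff_mem, hmapJ, hπΛ,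
      show Ideal.span {Ideal.Quotient.mk ((JJ ϖ i).map (algebraMap R Λ)) (algebraMap R Λ (ϖ i')) ^ 8}
          = (Ideal.span {algebraMap R Λ (ϖ i') ^ 8}).map (Ideal.Quotient.mk _) by
        rw [Ideal.map_span, Set.image_singleton, map_pow],
      Ideal.mem_quotient_iff_mem_sup, sup_comm]
  · -- compatibility of `φ_{i+1}` with `φ_i`
    intro c
    obtain ⟨c, rfl⟩ := Ideal.Quotient.mk_surjective c
    rw [hfC, φl_mk, φl_mk, hfΛ]
  · -- `𝔮_{i+1}` pulls back to `𝔮_i`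
    ext x
    obtain ⟨x, rfl⟩ := Ideal.Quotient.mk_surjective x
    rw [Ideal.mem_comap, hfΛ, Ideal.mem_quotient_iff_mem (map_JJ_le ϖ q hq (i + 1)),
      Ideal.mem_quotient_iff_mem (map_JJ_le ϖ q hq i)]

include hq in
/-- **The last step**: from `R/J_0`, `J_0 = 0`, back to `R` (a degenerate instance of the step
with `π = 0`, which is strictly standard). [folklore] -/
theorem step_zero (h : CanResolve (Rl ϖ 0) (φl ϖ φ 0) (ql ϖ q 0)) : CanResolve R φ q := by
  classical
  haveI : (ql ϖ q 0).IsPrime := ql_isPrime ϖ q hq 0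
  haveI : Algebra.FinitePresentation (Rl ϖ 0) (Cl ϖ 0 (C := C)) :=
    finitePresentation_quotient (JJ ϖ 0) (JJ_fg ϖ 0)
  let fC : C →ₐ[R] Cl ϖ 0 (C := C) := Ideal.Quotient.mkₐ R _
  let fΛ : Λ →ₐ[R] Λl ϖ 0 (Λ := Λ) := Ideal.Quotient.mkₐ R _
  have h0 : ∀ {T : Type u} [CommRing T] [Algebra R T],
      (JJ ϖ 0).map (algebraMap R T) = Ideal.span {algebraMap R T 0 ^ 8} := by
    intro T _ _
    rw [JJ_zero, Ideal.map_bot, map_zero, zero_pow (by norm_num), eq_comm, Ideal.span_singleton_eq_bot]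
  refine canResolve_of_canResolve_quotient φ q (0 : R) (fun s hs => by rw [zero_mul])
    (fun x hx => by rw [map_zero, zero_mul]) ?_ (Rl ϖ 0) Ideal.Quotient.mk_surjective ?_
    (Cl ϖ 0) fC Ideal.Quotient.mk_surjective ?_ (Λl ϖ 0) fΛ Ideal.Quotient.mk_surjective ?_
    (φl ϖ φ 0) (fun c => rfl) (ql ϖ q 0) ?_ h
  · rw [map_zero]
    exact Stacks07EZ.isStrictlyStandard_zero
  · rw [Ideal.Quotient.algebraMap_eq, Ideal.mk_ker, JJ_zero, zero_pow (by norm_num), eq_comm,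
      Ideal.span_singleton_eq_bot]
  · change RingHom.ker (Ideal.Quotient.mk _) = _
    rw [Ideal.mk_ker, h0]
  · change RingHom.ker (Ideal.Quotient.mk _) = _
    rw [Ideal.mk_ker, h0]
  · change (q.map (Ideal.Quotient.mk _)).comap (Ideal.Quotient.mk _) = q
    ext x
    rw [Ideal.mem_comap, Ideal.mem_quotient_iff_mem (map_JJ_le ϖ q hq 0)]

include hRann hΛann hss hq in
/-- **Stacks, Lemma 07F8** (specialised to the quotients `R/(ϖ_1⁸, …, ϖ_i⁸)`): if
`R/J_d → A/J_dA → Λ/J_dΛ ⊃ 𝔮/J_dΛ` can be resolved, so can `R → A → Λ ⊃ 𝔮`, by descending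
induction along the step. [cite: StacksProject, Tag 07F8] -/
theorem canResolve_of_canResolve_level
    (h : CanResolve (Rl ϖ d) (φl ϖ φ d) (ql ϖ q d)) : CanResolve R φ q := by
  have key : ∀ m, m ≤ d → CanResolve (Rl ϖ (d - m)) (φl ϖ φ (d - m)) (ql ϖ q (d - m)) := by
    intro m
    induction m with
    | zero => intro _; simpa using h
    | succ m ih =>
      intro hm
      have hlt : d - (m + 1) < d := by omega
      have := step_level ϖ φ q hq hRann hΛann hss (d - (m + 1)) hlt
        (by rw [show d - (m + 1) + 1 = d - m by omega]; exact ih (by omega))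
      exact this
  have := key d le_rfl
  rw [Nat.sub_self] at this
  exact step_zero ϖ φ q hq this

end Step

end Stacks07F8

end Literature.AlgebraicGeometry.Resolution

end
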